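import Summits.QuantumAdvantage.QuantumAdvantage.Theorems.RankDialL7
import HarnessLib

/-!
# RankDial (L8) — §40–§41 THE GENERATING-FUNCTION SKELETON OF A BLOCK LAW: `#WIN ≤ (2/3)·2^ℓ + 3^{J+1}·X`, canonical form

TARGET BY NAME (cell decomp-qadv, RESIDUAL MODE): item stmt-QuantumAdvantage-23109
`Summit.QuantumAdvantage.QuantumAdvantage.Theses.OddPrimeWalk.ManyReadersSqrtOdd`, through rung R5 = `AdviceFreeQNC0.WalkHardFLinSel p`.
This file SUPPORTS the item (`--supports`); it does not close it.  Declaration bodies are byte-identical to §40–§41 of the cell node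
«BlockDial» (decomp-qadv lens-1, generation 27, part L; node file RankDialL.lean, rev 5).  §40: orthogonality of the label characters
(`sum_stdAddChar_labelDot`: `Σ_t e₃(⟨t, w⟩) = 3^{J+1}·[w = 0]`), character detection of a label class
(`three_pow_mul_card_filter_label_le`: `3^{J+1}·#{v ∈ B : Z v = z} ≤ #B + Σ_{t ≠ 0} ‖Σ_{v ∈ B} e₃(⟨t, Z v⟩)‖`), sign-to-support
(`two_mul_norm_sum_filter_ne_zero_le`) and THE SKELETON `win_fibre_le_of_labelSums`: bounds `X` on the untwisted and the
`labelPar_z`-twisted label-character sums (`t ≠ 0`) give `#{v : WIN(a ++ v ++ b)} ≤ (2/3)·2^ℓ + 3^{J+1}·X` — the `J`-label analogue of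
part I2's `three_mul_win_fibre_le_of_bound`, valid for ARBITRARY pass patterns.  §41: the canonical global classification `gkindOf` /
`fibreLive` (no side conditions): `win_fibre_le_of_labelSums_canonical`, the inside-cut count `succ_card_insideCuts_fibreLive_mul_le`
(`(J+1)·⌊ℓ/η⌋ ≤ ℓ` on an `η`-separated block) and the part-L6 bound in canonical form `norm_twisted_blockLabel_fibreLive_le`.  Imports part L7.
-/

set_option linter.dupNamespace false
set_option autoImplicit false

noncomputable section
open Classical

namespace Summit.QuantumAdvantage.QuantumAdvantage.Theorems.RankDial

open Finset
open Summit.QuantumAdvantage.AdviceFreeQNC0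
open Literature.Computability.MetaComplexity Literature.Computability.MetaComplexity.Smolensky

/-! ### §40 (part L «BlockDial») CHARACTER DETECTION OF LABEL CLASSES and THE SKELETON THEOREM `#WIN ≤ (2/3)·2^ℓ + 3^{J+1}·X` -/

section LabelDetect
variable {L ℓ R : ℕ} (c : ℕ) (y : Fin (L + ℓ + R + 1) → (Fin (L + ℓ + R) → Bool) → Bool)
  (a : Fin L → Bool) (b : Fin R → Bool)

/-- Orthogonality in `ℤ₃`: `Σ_s e₃(s·w) = 3·[w = 0]`. -/
theorem sum_stdAddChar_mul_three (w : ZMod 3) :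
    ∑ s : ZMod 3, (ZMod.stdAddChar (s * w) : ℂ) = if w = 0 then (3 : ℂ) else 0 := by
  rw [AddChar.sum_mulShift w (ZMod.isPrimitive_stdAddChar 3), ZMod.card]
  split_ifs <;> simp

/-- **Orthogonality of the label characters**: `Σ_t e₃(⟨t, w⟩) = 3^{J+1}·[w = 0]` on `ℤ₃ × ℤ₃^J`. -/
theorem sum_stdAddChar_labelDot {J : ℕ} (w : ZMod 3 × (Fin J → ZMod 3)) :
    ∑ t : ZMod 3 × (Fin J → ZMod 3), (ZMod.stdAddChar (labelDot t w) : ℂ) = if w = 0 then (3 : ℂ) ^ (J + 1) else 0 := by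
  -- an additive character turns finite sums into products (folklore; kept local — the named lemma lives in the Literature tree)
  have hprod : ∀ (f : Fin J → ZMod 3) (S : Finset (Fin J)),
      (ZMod.stdAddChar (∑ j ∈ S, f j) : ℂ) = ∏ j ∈ S, (ZMod.stdAddChar (f j) : ℂ) := by
    intro f S
    induction S using Finset.induction_on with
    | empty => simp
    | insert j S hj ih => rw [Finset.sum_insert hj, Finset.prod_insert hj, AddChar.map_add_eq_mul, ih]
  have hsplit : ∀ t : ZMod 3 × (Fin J → ZMod 3), (ZMod.stdAddChar (labelDot t w) : ℂ) =
      (ZMod.stdAddChar (t.1 * w.1) : ℂ) * ∏ j, (ZMod.stdAddChar (t.2 j * w.2 j) : ℂ) := by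
    intro t
    rw [labelDot, AddChar.map_add_eq_mul, hprod]
  simp_rw [hsplit]
  rw [Fintype.sum_prod_type]
  simp only []
  rw [← Finset.sum_mul_sum, sum_stdAddChar_mul_three,
    ← Fintype.prod_sum (fun j (s : ZMod 3) => (ZMod.stdAddChar (s * w.2 j) : ℂ))]
  simp_rw [sum_stdAddChar_mul_three]
  by_cases hw : w = 0
  · rw [if_pos hw]
    simp only [hw, Prod.fst_zero, Prod.snd_zero, Pi.zero_apply, if_true, Finset.prod_const, Finset.card_univ,
      Fintype.card_fin]
    ring
  · rw [if_neg hw]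
    by_cases h1 : w.1 = 0
    · have h2 : ∃ j, w.2 j ≠ 0 := by
        by_contra hall
        exact hw (Prod.ext h1 (funext fun j => not_ne_iff.mp (not_exists.mp hall j)))
      obtain ⟨j, hj⟩ := h2
      rw [Finset.prod_eq_zero (Finset.mem_univ j) (by rw [if_neg hj]), mul_zero]
    · rw [if_neg h1, zero_mul]

/-- `labelDot t` is additive: `⟨t, w − z⟩ = ⟨t, w⟩ − ⟨t, z⟩`. -/
theorem labelDot_sub {J : ℕ} (t w z : ZMod 3 × (Fin J → ZMod 3)) : labelDot t (w - z) = labelDot t w - labelDot t z := by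
  simp only [labelDot, Prod.fst_sub, Prod.snd_sub, Pi.sub_apply, mul_sub, Finset.sum_sub_distrib]
  ring

/-- **Character detection of a label class**: for every set `B` of contents, labelling `Z` and label `z`,
`3^{J+1}·#{v ∈ B : Z v = z} ≤ #B + Σ_{t ≠ 0} ‖Σ_{v ∈ B} e₃(⟨t, Z v⟩)‖`. -/
theorem three_pow_mul_card_filter_label_le {J : ℕ} (B : Finset (Fin ℓ → Bool))
    (Z : (Fin ℓ → Bool) → ZMod 3 × (Fin J → ZMod 3)) (z : ZMod 3 × (Fin J → ZMod 3)) :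
    (3 : ℝ) ^ (J + 1) * ((B.filter fun v => Z v = z).card : ℝ) ≤
      B.card + ∑ t ∈ univ.erase (0 : ZMod 3 × (Fin J → ZMod 3)), ‖∑ v ∈ B, (ZMod.stdAddChar (labelDot t (Z v)) : ℂ)‖ := by
  have hind : ∀ v, ∑ t : ZMod 3 × (Fin J → ZMod 3), (ZMod.stdAddChar (labelDot t (Z v - z)) : ℂ) =
      if Z v = z then (3 : ℂ) ^ (J + 1) else 0 := by
    intro v
    rw [sum_stdAddChar_labelDot]
    simp only [sub_eq_zero]
  have hL : ((3 : ℂ) ^ (J + 1)) * ((B.filter fun v => Z v = z).card : ℂ) =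
      ∑ v ∈ B, ∑ t : ZMod 3 × (Fin J → ZMod 3), (ZMod.stdAddChar (labelDot t (Z v - z)) : ℂ) := by
    simp_rw [hind]
    rw [Finset.sum_ite, Finset.sum_const_zero, add_zero, Finset.sum_const, nsmul_eq_mul, mul_comm]
  have hR : ∑ v ∈ B, ∑ t : ZMod 3 × (Fin J → ZMod 3), (ZMod.stdAddChar (labelDot t (Z v - z)) : ℂ) =
      ∑ t : ZMod 3 × (Fin J → ZMod 3), (ZMod.stdAddChar (-labelDot t z) : ℂ) *
        ∑ v ∈ B, (ZMod.stdAddChar (labelDot t (Z v)) : ℂ) := by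
    rw [Finset.sum_comm]
    refine Finset.sum_congr rfl fun t _ => ?_
    rw [Finset.mul_sum]
    refine Finset.sum_congr rfl fun v _ => ?_
    rw [labelDot_sub, sub_eq_neg_add, AddChar.map_add_eq_mul]
  have h0 : (ZMod.stdAddChar (-labelDot (0 : ZMod 3 × (Fin J → ZMod 3)) z) : ℂ) *
      ∑ v ∈ B, (ZMod.stdAddChar (labelDot (0 : ZMod 3 × (Fin J → ZMod 3)) (Z v)) : ℂ) = B.card := by
    have hz : ∀ w : ZMod 3 × (Fin J → ZMod 3), labelDot 0 w = 0 := fun w => by simp [labelDot]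
    simp_rw [hz, neg_zero, AddChar.map_zero_eq_one, Finset.sum_const, nsmul_eq_mul, mul_one, one_mul]
  have key : (3 : ℝ) ^ (J + 1) * ((B.filter fun v => Z v = z).card : ℝ) =
      ‖∑ t : ZMod 3 × (Fin J → ZMod 3), (ZMod.stdAddChar (-labelDot t z) : ℂ) *
        ∑ v ∈ B, (ZMod.stdAddChar (labelDot t (Z v)) : ℂ)‖ := by
    rw [← hR, ← hL, norm_mul, norm_pow, Complex.norm_ofNat, Complex.norm_natCast]
  rw [key, ← Finset.add_sum_erase _ _ (Finset.mem_univ (0 : ZMod 3 × (Fin J → ZMod 3))), h0]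
  calc ‖(B.card : ℂ) + ∑ t ∈ univ.erase (0 : ZMod 3 × (Fin J → ZMod 3)), (ZMod.stdAddChar (-labelDot t z) : ℂ) *
          ∑ v ∈ B, (ZMod.stdAddChar (labelDot t (Z v)) : ℂ)‖
      ≤ ‖(B.card : ℂ)‖ + ‖∑ t ∈ univ.erase (0 : ZMod 3 × (Fin J → ZMod 3)), (ZMod.stdAddChar (-labelDot t z) : ℂ) *
          ∑ v ∈ B, (ZMod.stdAddChar (labelDot t (Z v)) : ℂ)‖ := norm_add_le _ _
    _ ≤ (B.card : ℝ) + ∑ t ∈ univ.erase (0 : ZMod 3 × (Fin J → ZMod 3)), ‖(ZMod.stdAddChar (-labelDot t z) : ℂ) *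
          ∑ v ∈ B, (ZMod.stdAddChar (labelDot t (Z v)) : ℂ)‖ := by
        rw [Complex.norm_natCast]
        exact add_le_add le_rfl (norm_sum_le _ _)
    _ = (B.card : ℝ) + ∑ t ∈ univ.erase (0 : ZMod 3 × (Fin J → ZMod 3)), ‖∑ v ∈ B, (ZMod.stdAddChar (labelDot t (Z v)) : ℂ)‖ := by
        congr 1
        refine Finset.sum_congr rfl fun t _ => ?_
        rw [norm_mul, AddChar.norm_apply, one_mul]

omit c y a b in
/-- From sign to support: `2‖Σ_{v : Q v ≠ 0} f v‖ ≤ ‖Σ_v f v‖ + ‖Σ_v (−1)^{Q v} f v‖` (`𝟙[Q ≠ 0] = (1 − (−1)^Q)/2`). -/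
theorem two_mul_norm_sum_filter_ne_zero_le (Q : CubeFn (ZMod 2) ℓ) (f : (Fin ℓ → Bool) → ℂ) :
    2 * ‖∑ v ∈ univ.filter (fun v : Fin ℓ → Bool => Q v ≠ 0), f v‖ ≤
      ‖∑ v : Fin ℓ → Bool, f v‖ + ‖∑ v : Fin ℓ → Bool, GowersCube.signChar (Q v) * f v‖ := by
  have hid : (2 : ℂ) * ∑ v ∈ univ.filter (fun v : Fin ℓ → Bool => Q v ≠ 0), f v =
      (∑ v : Fin ℓ → Bool, f v) - ∑ v : Fin ℓ → Bool, GowersCube.signChar (Q v) * f v := by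
    rw [Finset.sum_filter, Finset.mul_sum, ← Finset.sum_sub_distrib]
    refine Finset.sum_congr rfl fun v _ => ?_
    by_cases hv : Q v = 0
    · simp [hv]
    · simp [hv, GowersCube.signChar]
      ring
  calc 2 * ‖∑ v ∈ univ.filter (fun v : Fin ℓ → Bool => Q v ≠ 0), f v‖
      = ‖(2 : ℂ) * ∑ v ∈ univ.filter (fun v : Fin ℓ → Bool => Q v ≠ 0), f v‖ := by
        rw [norm_mul, Complex.norm_ofNat]
    _ = ‖(∑ v : Fin ℓ → Bool, f v) - ∑ v : Fin ℓ → Bool, GowersCube.signChar (Q v) * f v‖ := by rw [hid]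
    _ ≤ ‖∑ v : Fin ℓ → Bool, f v‖ + ‖∑ v : Fin ℓ → Bool, GowersCube.signChar (Q v) * f v‖ := norm_sub_le _ _

/-- **THE GENERATING-FUNCTION SKELETON OF A BLOCK LAW** (arbitrary pass patterns; the `J`-label analogue of part I2's
`three_mul_win_fibre_le_of_bound`).  Fix an outside fibre `(a, b)`, inside positions `h`, and a global classification `kind` of the cuts
(`none` ⟹ outside the block OR never passing on this fibre; `some j` ⟹ at `h j`, `L < h j < L + ℓ`).  If for every label-character index
`t ≠ 0` the untwisted sums `‖Σ_v e₃(⟨t, blockLabel v⟩)‖` and, for every label `z`, the twisted sums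
`‖Σ_v (−1)^{labelPar z v}·e₃(⟨t, blockLabel v⟩)‖` are `≤ X`, then `#{v : WIN(a ++ v ++ b)} ≤ (2/3)·2^ℓ + 3^{J+1}·X`.
Proof: WIN(v) ⟺ `labelPar_{Z v} v ≠ 0` (`ringWinU_glue3_iff_labelPar`); fibre over `z = Z v`; detect `Z v = z` on `B_z = {labelPar_z ≠ 0}`
by the label characters (`three_pow_mul_card_filter_label_le`, `two_mul_norm_sum_filter_ne_zero_le`); `Σ_z #B_z ≤ 2·3^J·2^ℓ`
(`sum_card_labelPar_ne_zero_le` = §31 multi-liveness per content).  The level-set expansion of the window forms (part I1) and §38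
`norm_twisted_blockLabel_le_of_sepBlock` supply `X` for `η`-separated strategies of small junta-rank. -/
theorem win_fibre_le_of_labelSums {J : ℕ} (h : Fin J → ℕ) (kind : Fin (L + ℓ + R + 1) → Option (Fin J))
    (hnone : ∀ g, kind g = none → (g.val ≤ L ∨ L + ℓ ≤ g.val ∨ ∀ v : Fin ℓ → Bool, y g (glue3 a v b) = false))
    (hsome : ∀ g j, kind g = some j → g.val = h j ∧ L < h j ∧ h j < L + ℓ) {X : ℝ}
    (hU : ∀ t : ZMod 3 × (Fin J → ZMod 3), t ≠ 0 →
      ‖∑ v : Fin ℓ → Bool, (ZMod.stdAddChar (labelDot t (blockLabel L h v)) : ℂ)‖ ≤ X)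
    (hT : ∀ z t : ZMod 3 × (Fin J → ZMod 3), t ≠ 0 →
      ‖∑ v : Fin ℓ → Bool, GowersCube.signChar (labelPar c y a b kind z v) *
        (ZMod.stdAddChar (labelDot t (blockLabel L h v)) : ℂ)‖ ≤ X) :
    ((univ.filter fun v : Fin ℓ → Bool => ringWinU c y (glue3 a v b) = true).card : ℝ) ≤
      2 / 3 * 2 ^ ℓ + 3 ^ (J + 1) * X := by
  set B : ZMod 3 × (Fin J → ZMod 3) → Finset (Fin ℓ → Bool) :=
    fun z => univ.filter fun v : Fin ℓ → Bool => labelPar c y a b kind z v ≠ 0 with hB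
  have hX : 0 ≤ X := (norm_nonneg _).trans (hU ((1 : ZMod 3), fun _ => 0) (by simp [Prod.ext_iff]))
  -- (1) WIN, fibred over the own label
  have hwin : ((univ.filter fun v : Fin ℓ → Bool => ringWinU c y (glue3 a v b) = true).card : ℝ) =
      ∑ z : ZMod 3 × (Fin J → ZMod 3), (((B z).filter fun v => blockLabel L h v = z).card : ℝ) := by
    have e : (univ.filter fun v : Fin ℓ → Bool => ringWinU c y (glue3 a v b) = true) =
        univ.filter fun v : Fin ℓ → Bool => labelPar c y a b kind (blockLabel L h v) v ≠ 0 :=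
      Finset.filter_congr fun v _ => ringWinU_glue3_iff_labelPar c y a b h kind hnone hsome v
    have hfib : (univ.filter fun v : Fin ℓ → Bool => labelPar c y a b kind (blockLabel L h v) v ≠ 0).card =
        ∑ z : ZMod 3 × (Fin J → ZMod 3), ((univ.filter fun v : Fin ℓ → Bool =>
          labelPar c y a b kind (blockLabel L h v) v ≠ 0).filter fun v => blockLabel L h v = z).card := by
      apply Finset.card_eq_sum_card_fiberwise
      intro v _
      exact Finset.mem_coe.2 (Finset.mem_univ _)
    have hcl : ∀ z : ZMod 3 × (Fin J → ZMod 3), ((univ.filter fun v : Fin ℓ → Bool =>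
        labelPar c y a b kind (blockLabel L h v) v ≠ 0).filter fun v => blockLabel L h v = z) =
        (B z).filter fun v => blockLabel L h v = z := by
      intro z
      ext v
      simp only [hB, Finset.mem_filter, Finset.mem_univ, true_and]
      constructor
      · rintro ⟨hv, hz⟩
        rw [hz] at hv
        exact ⟨hv, hz⟩
      · rintro ⟨hv, hz⟩
        rw [← hz] at hv
        exact ⟨hv, hz⟩
    rw [e, hfib]
    push_cast
    exact Finset.sum_congr rfl fun z _ => by rw [hcl z]
  -- (2) per label: character detection on `B z`
  have hcard : ((univ.erase (0 : ZMod 3 × (Fin J → ZMod 3))).card : ℝ) = 3 ^ (J + 1) - 1 := by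
    rw [Finset.card_erase_of_mem (Finset.mem_univ _), Finset.card_univ, card_label_space,
      Nat.cast_sub (Nat.one_le_pow _ _ (by norm_num)), Nat.cast_pow]
    norm_num
  have hz : ∀ z : ZMod 3 × (Fin J → ZMod 3),
      (3 : ℝ) ^ (J + 1) * (((B z).filter fun v => blockLabel L h v = z).card : ℝ) ≤ ((B z).card : ℝ) + (3 ^ (J + 1) - 1) * X := by
    intro z
    refine (three_pow_mul_card_filter_label_le (B z) (fun v => blockLabel L h v) z).trans (add_le_add le_rfl ?_)
    calc ∑ t ∈ univ.erase (0 : ZMod 3 × (Fin J → ZMod 3)), ‖∑ v ∈ B z, (ZMod.stdAddChar (labelDot t (blockLabel L h v)) : ℂ)‖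
        ≤ ∑ _t ∈ univ.erase (0 : ZMod 3 × (Fin J → ZMod 3)), X := by
          refine Finset.sum_le_sum fun t ht => ?_
          have ht0 : t ≠ 0 := Finset.ne_of_mem_erase ht
          have h2 := two_mul_norm_sum_filter_ne_zero_le (labelPar c y a b kind z)
            (fun v => (ZMod.stdAddChar (labelDot t (blockLabel L h v)) : ℂ))
          have hu := hU t ht0
          have htw := hT z t ht0
          simp only [hB]
          linarith
      _ = (3 ^ (J + 1) - 1) * X := by rw [Finset.sum_const, nsmul_eq_mul, hcard]
  -- (3) sum over the labels
  have hBsum : (∑ z : ZMod 3 × (Fin J → ZMod 3), ((B z).card : ℝ)) ≤ 2 * 3 ^ J * 2 ^ ℓ := by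
    have hs := sum_card_labelPar_ne_zero_le c y a b kind
    have hs' : ((∑ z : ZMod 3 × (Fin J → ZMod 3), (B z).card : ℕ) : ℝ) ≤ ((2 * 3 ^ J * 2 ^ ℓ : ℕ) : ℝ) := by
      exact_mod_cast hs
    push_cast at hs'
    exact hs'
  have hmain : (3 : ℝ) ^ (J + 1) * ((univ.filter fun v : Fin ℓ → Bool => ringWinU c y (glue3 a v b) = true).card : ℝ) ≤
      2 * 3 ^ J * 2 ^ ℓ + 3 ^ (J + 1) * ((3 ^ (J + 1) - 1) * X) := by
    rw [hwin, Finset.mul_sum]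
    calc ∑ z : ZMod 3 × (Fin J → ZMod 3), (3 : ℝ) ^ (J + 1) * (((B z).filter fun v => blockLabel L h v = z).card : ℝ)
        ≤ ∑ z : ZMod 3 × (Fin J → ZMod 3), (((B z).card : ℝ) + (3 ^ (J + 1) - 1) * X) := Finset.sum_le_sum fun z _ => hz z
      _ = (∑ z : ZMod 3 × (Fin J → ZMod 3), ((B z).card : ℝ)) + 3 ^ (J + 1) * ((3 ^ (J + 1) - 1) * X) := by
          rw [Finset.sum_add_distrib, Finset.sum_const, Finset.card_univ, card_label_space, nsmul_eq_mul]
          push_cast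
          ring
      _ ≤ 2 * 3 ^ J * 2 ^ ℓ + 3 ^ (J + 1) * ((3 ^ (J + 1) - 1) * X) := by linarith
  have hA : (0 : ℝ) < 3 ^ J := by positivity
  have h3 : (3 : ℝ) ^ (J + 1) = 3 * 3 ^ J := by rw [pow_succ, mul_comm]
  rw [h3] at hmain ⊢
  have hfin : 3 * (3 : ℝ) ^ J * ((univ.filter fun v : Fin ℓ → Bool => ringWinU c y (glue3 a v b) = true).card : ℝ) ≤
      3 * 3 ^ J * (2 / 3 * 2 ^ ℓ + 3 * 3 ^ J * X) := by
    have e : 3 * (3 : ℝ) ^ J * (2 / 3 * 2 ^ ℓ + 3 * 3 ^ J * X) =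
        2 * 3 ^ J * 2 ^ ℓ + 3 * 3 ^ J * ((3 * 3 ^ J - 1) * X) + 3 * 3 ^ J * X := by ring
    rw [e]
    have hmain' : 3 * (3 : ℝ) ^ J * ((univ.filter fun v : Fin ℓ → Bool => ringWinU c y (glue3 a v b) = true).card : ℝ) ≤
        2 * 3 ^ J * 2 ^ ℓ + 3 * 3 ^ J * ((3 * 3 ^ J - 1) * X) := by
      simpa [mul_assoc] using hmain
    nlinarith [mul_nonneg (by positivity : (0 : ℝ) ≤ 3 * 3 ^ J) hX]
  exact le_of_mul_le_mul_left hfin (by positivity)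

end LabelDetect

/-! ### §41 (part L «BlockDial») THE CANONICAL GLOBAL CLASSIFICATION: skeleton, inside-cut count and §38 bound with NO side conditions -/

section CanonicalGF
variable {L ℓ R : ℕ} (c : ℕ) (y : Fin (L + ℓ + R + 1) → (Fin (L + ℓ + R) → Bool) → Bool)
  (a : Fin L → Bool) (b : Fin R → Bool)

/-- The canonical GLOBAL classification relative to a cut set `P`: an inside cut of `P` ↦ its rank among the inside cuts of `P`,
every other cut ↦ `none` (the global twin of §34 `kindOf`, which classifies only the members of `P`). -/
def gkindOf (L ℓ : ℕ) {n : ℕ} (P : Finset (Fin (n + 1))) (g : Fin (n + 1)) : Option (Fin (insideCuts L ℓ P).card) :=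
  if hg : g ∈ insideCuts L ℓ P then some (((insideCuts L ℓ P).orderIsoOfFin rfl).symm ⟨g, hg⟩) else none

/-- `gkindOf = none` ⟹ the cut is not in `P`, or outside the block (or on its boundary). -/
theorem gkindOf_none {n : ℕ} (P : Finset (Fin (n + 1))) (g : Fin (n + 1)) (h : gkindOf L ℓ P g = none) :
    g ∉ P ∨ g.val ≤ L ∨ L + ℓ ≤ g.val := by
  unfold gkindOf at h
  by_cases hg : g ∈ insideCuts L ℓ P
  · rw [dif_pos hg] at h
    exact absurd h (Option.some_ne_none _)
  · by_cases hP : g ∈ P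
    · have h' : ¬ (L < g.val ∧ g.val < L + ℓ) := fun h' => hg (Finset.mem_filter.mpr ⟨hP, h'⟩)
      right
      omega
    · exact Or.inl hP

/-- `gkindOf = some j` ⟹ the cut sits at the `j`-th canonical inside position, strictly inside the block. -/
theorem gkindOf_some {n : ℕ} (P : Finset (Fin (n + 1))) (g : Fin (n + 1)) (j : Fin (insideCuts L ℓ P).card)
    (h : gkindOf L ℓ P g = some j) : g.val = posOf L ℓ P j ∧ L < posOf L ℓ P j ∧ posOf L ℓ P j < L + ℓ := by
  unfold gkindOf at h
  by_cases hg : g ∈ insideCuts L ℓ P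
  · rw [dif_pos hg] at h
    have hj : ((insideCuts L ℓ P).orderIsoOfFin rfl).symm ⟨g, hg⟩ = j := Option.some_injective _ h
    have hgj : ((insideCuts L ℓ P).orderEmbOfFin rfl j) = g := by
      rw [← Finset.coe_orderIsoOfFin_apply, ← hj, OrderIso.apply_symm_apply]
    have hmem := (Finset.mem_filter.mp (Finset.orderEmbOfFin_mem (insideCuts L ℓ P) rfl j)).2
    unfold posOf
    exact ⟨by rw [hgj], hmem.1, hmem.2⟩
  · rw [dif_neg hg] at h
    exact absurd h.symm (Option.some_ne_none _)

/-- The cuts that pass somewhere on the outside fibre `(a, b)` (a subset of the live cuts). -/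
def fibreLive : Finset (Fin (L + ℓ + R + 1)) :=
  univ.filter fun g : Fin (L + ℓ + R + 1) => ∃ v : Fin ℓ → Bool, y g (glue3 a v b) = true

/-- A fibre-live cut is live. -/
theorem live_of_mem_fibreLive {g : Fin (L + ℓ + R + 1)} (hg : g ∈ fibreLive y a b) : Live y g := by
  obtain ⟨v, hv⟩ := (Finset.mem_filter.mp hg).2
  exact ⟨glue3 a v b, hv⟩

/-- **THE GENERATING-FUNCTION SKELETON WITH NO SIDE CONDITIONS** (every table, charge, block, outside fibre): classify by
`gkindOf L ℓ (fibreLive y a b)` and `posOf L ℓ (fibreLive y a b)`; then bounds `X` on the `3^{J+1} − 1` untwisted and on the twisted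
label-character sums give `#{v : WIN(a ++ v ++ b)} ≤ (2/3)·2^ℓ + 3^{J+1}·X`, `J` = the number of inside fibre-live cuts. -/
theorem win_fibre_le_of_labelSums_canonical {X : ℝ}
    (hU : ∀ t : ZMod 3 × (Fin (insideCuts L ℓ (fibreLive y a b)).card → ZMod 3), t ≠ 0 →
      ‖∑ v : Fin ℓ → Bool, (ZMod.stdAddChar (labelDot t (blockLabel L (posOf L ℓ (fibreLive y a b)) v)) : ℂ)‖ ≤ X)
    (hT : ∀ z t : ZMod 3 × (Fin (insideCuts L ℓ (fibreLive y a b)).card → ZMod 3), t ≠ 0 →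
      ‖∑ v : Fin ℓ → Bool, GowersCube.signChar (labelPar c y a b (gkindOf L ℓ (fibreLive y a b)) z v) *
        (ZMod.stdAddChar (labelDot t (blockLabel L (posOf L ℓ (fibreLive y a b)) v)) : ℂ)‖ ≤ X) :
    ((univ.filter fun v : Fin ℓ → Bool => ringWinU c y (glue3 a v b) = true).card : ℝ) ≤
      2 / 3 * 2 ^ ℓ + 3 ^ ((insideCuts L ℓ (fibreLive y a b)).card + 1) * X := by
  refine win_fibre_le_of_labelSums c y a b (posOf L ℓ (fibreLive y a b)) (gkindOf L ℓ (fibreLive y a b))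
    (fun g hg => ?_) (fun g j hg => gkindOf_some _ g j hg) hU hT
  rcases gkindOf_none _ g hg with h1 | h1 | h1
  · refine Or.inr (Or.inr fun v => ?_)
    by_contra hv
    have ht : y g (glue3 a v b) = true := by simpa using hv
    exact h1 (Finset.mem_filter.mpr ⟨Finset.mem_univ _, v, ht⟩)
  · exact Or.inl h1
  · exact Or.inr (Or.inl h1)

/-- The number `J` of inside fibre-live cuts of an `η`-separated block: `(J + 1)·⌊ℓ/η⌋ ≤ ℓ` (§35). -/
theorem succ_card_insideCuts_fibreLive_mul_le {η : ℕ} (hsep : SepBlock y L ℓ η) :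
    ((insideCuts L ℓ (fibreLive y a b)).card + 1) * (ℓ / η) ≤ ℓ :=
  succ_card_insideCuts_mul_le y hsep (fibreLive y a b) fun _ hg => live_of_mem_fibreLive y a b hg

/-- **The §38 bound for the canonical positions of an `η`-separated block** (`p ≠ 3`, `Q ∈ lowDeg 𝔽₂ ℓ s`, any `μ`, `t ≠ 0`):
`‖Σ_v (−1)^{Q v}·e₃(⟨t, blockLabel L (posOf L ℓ (fibreLive y a b)) v⟩)·e_p(μ·v)‖ ≤ 2^ℓ·exp(−η_p·⌊ℓ/η⌋/4^{s+1})` — the pieces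
into which the level-set expansion (part I1) splits the sums `hU`, `hT` of `win_fibre_le_of_labelSums_canonical`. -/
theorem norm_twisted_blockLabel_fibreLive_le {p : ℕ} [Fact p.Prime] (hp3 : p ≠ 3) {η : ℕ} (hsep : SepBlock y L ℓ η)
    {s : ℕ} {Q : CubeFn (ZMod 2) ℓ} (hQ : Q ∈ lowDeg (ZMod 2) ℓ s) (μ : Fin ℓ → ZMod p)
    (t : ZMod 3 × (Fin (insideCuts L ℓ (fibreLive y a b)).card → ZMod 3)) (ht : t ≠ 0) :
    ‖∑ v : Fin ℓ → Bool, GowersCube.signChar (Q v) *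
        ((ZMod.stdAddChar (labelDot t (blockLabel L (posOf L ℓ (fibreLive y a b)) v)) : ℂ) * ZMod.stdAddChar (linPart μ v))‖ ≤
      2 ^ ℓ * Real.exp (-(etaP p * (ℓ / η : ℕ) / 4 ^ (s + 1))) :=
  norm_twisted_blockLabel_le_of_sepBlock hp3 y hsep (fibreLive y a b) (fun _ hg => live_of_mem_fibreLive y a b hg) hQ μ t ht

end CanonicalGF

end Summit.QuantumAdvantage.QuantumAdvantage.Theorems.RankDial
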